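import Summits.CriticalPhenomena.CardyFormulaZ2.Theorems.CardyBoundaryCoulombGasPureProductIntegrates

/-!
# The pure product integrates to Cardy's formula: improper-integral form
# (helper for `DensityIntegration`, item stmt-CriticalPhenomena-14890, route CardyBoundaryCoulombGas)

The continuum half of the density-integration step. In the uniformizing coordinate `u ∈ ℝ = ∂ℍ`
with marks `a < b < c`, the mark density of the engine crux is the pure product
`ρ(u) = (cardyConst/3) · ((b−a)(c−b)(c−a))^{1/3} · ((u−a)(u−b)(u−c))^{−2/3}` on `(c, ∞)`.
We prove that `ρ` is integrable on every `(c, X)` (the singularity `(u−c)^{−2/3}` at `c` is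
integrable) and that `∫_{(c,X)} ρ = F(η(a,b,c,X))`, `F` Cardy's function, `η` Cardy's cross-ratio
(fundamental theorem of calculus with the singular endpoint `c`, using
`hasDerivAt_cardyFunction_crossRatio` and `tendsto_cardyFunction_crossRatio_right` of the
`PureProductIntegrates` file). This is the value the lattice sums of mark densities converge to.
-/

noncomputable section

open Set Filter Topology MeasureTheory intervalIntegral

namespace Summit.CriticalPhenomena.CardyFormulaZ2.Theorems

open Literature.Probability.RandomPlanarGeometry

/-- The pure-product kernel `u ↦ ((u−a)(u−b)(u−c))^{−2/3}` is continuous on `(c, ∞)` for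
`a < b < c` (the base is positive there). [folklore] -/
theorem continuousOn_pureProductKernel {a b c : ℝ} (hab : a < b) (hbc : b < c) :
    ContinuousOn (fun u : ℝ ↦ ((u - a) * (u - b) * (u - c)) ^ (-(2 / 3) : ℝ)) (Ioi c) := by
  refine ContinuousOn.rpow_const (by fun_prop) fun u hu ↦ Or.inl ?_
  have h1 : 0 < u - a := by linarith [mem_Ioi.1 hu]
  have h2 : 0 < u - b := by linarith [mem_Ioi.1 hu]
  have h3 : 0 < u - c := by linarith [mem_Ioi.1 hu]
  positivity

/-- Cardy's pure-product density `ρ(u) = (cardyConst/3)·Δ^{1/3}·((u−a)(u−b)(u−c))^{−2/3}` is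
continuous on `(c, ∞)` (`a < b < c`). [folklore] -/
theorem continuousOn_pureProduct {a b c : ℝ} (hab : a < b) (hbc : b < c) :
    ContinuousOn (fun u : ℝ ↦ cardyConst / 3 * ((b - a) * (c - b) * (c - a)) ^ (1 / 3 : ℝ) *
      ((u - a) * (u - b) * (u - c)) ^ (-(2 / 3) : ℝ)) (Ioi c) :=
  continuousOn_const.mul (continuousOn_pureProductKernel hab hbc)

/-- Pointwise domination of the pure-product kernel on `(c, ∞)` by the model singularity:
`((u−a)(u−b)(u−c))^{−2/3} ≤ ((c−a)(c−b))^{−2/3} · (u−c)^{−2/3}` for `a < b < c < u`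
(`x ↦ x^{−2/3}` is antitone and `(c−a)(c−b) ≤ (u−a)(u−b)`). [folklore] -/
theorem pureProductKernel_le {a b c u : ℝ} (hab : a < b) (hbc : b < c) (hcu : c < u) :
    ((u - a) * (u - b) * (u - c)) ^ (-(2 / 3) : ℝ) ≤
      ((c - a) * (c - b)) ^ (-(2 / 3) : ℝ) * (u - c) ^ (-(2 / 3) : ℝ) := by
  have h1 : 0 < u - a := by linarith
  have h2 : 0 < u - b := by linarith
  have h3 : 0 < u - c := by linarith
  have hca : 0 < c - a := by linarith
  have hcb : 0 < c - b := by linarith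
  rw [Real.mul_rpow (by positivity) h3.le]
  refine mul_le_mul_of_nonneg_right ?_ (Real.rpow_nonneg h3.le _)
  refine Real.rpow_le_rpow_of_nonpos (by positivity) ?_ (by norm_num)
  exact mul_le_mul (by linarith) (by linarith) hcb.le h1.le

/-- The pure-product kernel is integrable on `(c, X)`: it is continuous there and dominated by
`const · (u−c)^{−2/3}`, and `−2/3 > −1`. [folklore] -/
theorem integrableOn_pureProductKernel {a b c X : ℝ} (hab : a < b) (hbc : b < c) (hcX : c < X) :
    IntegrableOn (fun u : ℝ ↦ ((u - a) * (u - b) * (u - c)) ^ (-(2 / 3) : ℝ)) (Ioo c X) := by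
  -- the model singularity `(u - c)^{-2/3}` is interval-integrable
  have hmodel : IntervalIntegrable (fun u : ℝ ↦ (u - c) ^ (-(2 / 3) : ℝ)) volume c X := by
    have h := (intervalIntegral.intervalIntegrable_rpow' (a := 0) (b := X - c)
      (r := -(2 / 3 : ℝ)) (by norm_num)).comp_sub_right c
    simpa only [zero_add, sub_add_cancel] using h
  have hmodel' : IntegrableOn (fun u : ℝ ↦ ((c - a) * (c - b)) ^ (-(2 / 3) : ℝ) * (u - c) ^ (-(2 / 3) : ℝ))
      (Ioo c X) := by
    have := (intervalIntegrable_iff_integrableOn_Ioo_of_le hcX.le).1 hmodel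
    exact this.const_mul _
  refine Integrable.mono' hmodel' ?_ ?_
  · exact ((continuousOn_pureProductKernel hab hbc).mono Ioo_subset_Ioi_self).aestronglyMeasurable
      measurableSet_Ioo
  · refine (ae_restrict_iff' measurableSet_Ioo).2 (Eventually.of_forall fun u hu ↦ ?_)
    have h1 : 0 < u - a := by linarith [hu.1]
    have h2 : 0 < u - b := by linarith [hu.1]
    have h3 : 0 < u - c := by linarith [hu.1]
    rw [Real.norm_of_nonneg (Real.rpow_nonneg (by positivity) _)]
    exact pureProductKernel_le hab hbc hu.1

/-- Cardy's pure-product density is integrable on `(c, X)`. [folklore] -/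
theorem integrableOn_pureProduct {a b c X : ℝ} (hab : a < b) (hbc : b < c) (hcX : c < X) :
    IntegrableOn (fun u : ℝ ↦ cardyConst / 3 * ((b - a) * (c - b) * (c - a)) ^ (1 / 3 : ℝ) *
      ((u - a) * (u - b) * (u - c)) ^ (-(2 / 3) : ℝ)) (Ioo c X) :=
  (integrableOn_pureProductKernel hab hbc hcX).const_mul _

/-- **Density integration, continuum half.** For `a < b < c < X`,
`∫_{(c,X)} (cardyConst/3)·((b−a)(c−b)(c−a))^{1/3}·((u−a)(u−b)(u−c))^{−2/3} du = F(η(a,b,c,X))`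
with `F = cardyFunction`, `η = crossRatio`: the fundamental theorem of calculus on `(c, X)` with the
singular endpoint `c`, antiderivative `F ∘ η` (`hasDerivAt_cardyFunction_crossRatio`), right limit
`0` at `c` (`tendsto_cardyFunction_crossRatio_right`) and integrability of the density
(Cardy 1992 eq. (8), (11); Dubédat 2005 §4). [folklore] -/
theorem setIntegral_pureProduct_eq_cardyFunction {a b c X : ℝ} (hab : a < b) (hbc : b < c)
    (hcX : c < X) :
    ∫ u in Ioo c X, cardyConst / 3 * ((b - a) * (c - b) * (c - a)) ^ (1 / 3 : ℝ) *
        ((u - a) * (u - b) * (u - c)) ^ (-(2 / 3) : ℝ) =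
      cardyFunction (crossRatio ![a, b, c, X]) := by
  have hint : IntervalIntegrable (fun u : ℝ ↦ cardyConst / 3 * ((b - a) * (c - b) * (c - a)) ^ (1 / 3 : ℝ) *
      ((u - a) * (u - b) * (u - c)) ^ (-(2 / 3) : ℝ)) volume c X :=
    (intervalIntegrable_iff_integrableOn_Ioo_of_le hcX.le).2 (integrableOn_pureProduct hab hbc hcX)
  have hderiv : ∀ u ∈ Ioo c X, HasDerivAt (fun y : ℝ ↦ cardyFunction (crossRatio ![a, b, c, y]))
      (cardyConst / 3 * ((b - a) * (c - b) * (c - a)) ^ (1 / 3 : ℝ) *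
        ((u - a) * (u - b) * (u - c)) ^ (-(2 / 3) : ℝ)) u :=
    fun u hu ↦ hasDerivAt_cardyFunction_crossRatio hab hbc hu.1
  have hleft := tendsto_cardyFunction_crossRatio_right hab hbc
  have hright : Tendsto (fun y : ℝ ↦ cardyFunction (crossRatio ![a, b, c, y])) (𝓝[<] X)
      (𝓝 (cardyFunction (crossRatio ![a, b, c, X]))) :=
    ((hasDerivAt_cardyFunction_crossRatio hab hbc hcX).continuousAt.tendsto).mono_left
      nhdsWithin_le_nhds
  have hFTC := intervalIntegral.integral_eq_sub_of_hasDerivAt_of_tendsto hcX hderiv hint hleft hright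
  rw [sub_zero, intervalIntegral.integral_of_le hcX.le, integral_Ioc_eq_integral_Ioo] at hFTC
  exact hFTC

/-! ### The half-infinite pieces: total mass of the pure product (pins the crux's constant) -/

/-- Cardy's cross-ratio of `(a, b, c, X)` tends to `η∞ = (b−a)/(c−a)` as the fourth point
`X → +∞` (the sink runs off to the point at infinity of `∂ℍ`). [folklore] -/
theorem tendsto_crossRatio_fourth_atTop {a b c : ℝ} (hab : a < b) (hbc : b < c) :
    Tendsto (fun X : ℝ ↦ crossRatio ![a, b, c, X]) atTop (𝓝 ((b - a) / (c - a))) := by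
  have hca : c - a ≠ 0 := (sub_pos.2 (hab.trans hbc)).ne'
  have hfun : (fun X : ℝ ↦ crossRatio ![a, b, c, X]) =ᶠ[atTop]
      fun X : ℝ ↦ (b - a) / (c - a) * (1 + (b - c) * (X - b)⁻¹) := by
    filter_upwards [eventually_gt_atTop b] with X hX
    have hxb : X - b ≠ 0 := (sub_pos.2 hX).ne'
    rw [crossRatio_abcx]
    field_simp
    ring
  refine Tendsto.congr' hfun.symm ?_
  have hinv : Tendsto (fun X : ℝ ↦ (X - b)⁻¹) atTop (𝓝 0) :=
    tendsto_inv_atTop_zero.comp (tendsto_atTop_add_const_right _ _ tendsto_id)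
  have : Tendsto (fun X : ℝ ↦ (b - a) / (c - a) * (1 + (b - c) * (X - b)⁻¹)) atTop
      (𝓝 ((b - a) / (c - a) * (1 + (b - c) * 0))) :=
    ((hinv.const_mul _).const_add _).const_mul _
  simpa using this

/-- For `u > c + 1` the pure-product kernel is dominated by `((u − c)²)⁻¹`. [folklore] -/
theorem pureProductKernel_le_inv_sq {a b c u : ℝ} (hab : a < b) (hbc : b < c) (hcu : c < u) :
    ((u - a) * (u - b) * (u - c)) ^ (-(2 / 3) : ℝ) ≤ ((u - c) ^ 2)⁻¹ := by
  have h3 : 0 < u - c := by linarith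
  have hle : (u - c) ^ 3 ≤ (u - a) * (u - b) * (u - c) := by
    have h1 : u - c ≤ u - a := by linarith
    have h2 : u - c ≤ u - b := by linarith
    calc (u - c) ^ 3 = (u - c) * (u - c) * (u - c) := by ring
      _ ≤ (u - a) * (u - b) * (u - c) := by
          refine mul_le_mul_of_nonneg_right (mul_le_mul h1 h2 h3.le (by linarith)) h3.le
  calc ((u - a) * (u - b) * (u - c)) ^ (-(2 / 3) : ℝ)
      ≤ ((u - c) ^ 3) ^ (-(2 / 3) : ℝ) := Real.rpow_le_rpow_of_nonpos (by positivity) hle (by norm_num)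
    _ = ((u - c) ^ 2)⁻¹ := by
        rw [show ((u - c) ^ 3 : ℝ) = (u - c) ^ ((3 : ℕ) : ℝ) from (Real.rpow_natCast _ 3).symm,
          ← Real.rpow_mul h3.le, show ((3 : ℕ) : ℝ) * (-(2 / 3 : ℝ)) = -((2 : ℕ) : ℝ) by norm_num,
          Real.rpow_neg h3.le, Real.rpow_natCast]

/-- The pure-product kernel is integrable on the half-line `(c, ∞)`: near `c` by
`integrableOn_pureProductKernel`, at infinity by domination with `((u−c)²)⁻¹`, the derivative of
`−(u−c)⁻¹ → 0`. [folklore] -/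
theorem integrableOn_pureProductKernel_Ioi {a b c : ℝ} (hab : a < b) (hbc : b < c) :
    IntegrableOn (fun u : ℝ ↦ ((u - a) * (u - b) * (u - c)) ^ (-(2 / 3) : ℝ)) (Ioi c) := by
  have hcont := continuousOn_pureProductKernel hab hbc
  -- the tail `(c + 1, ∞)`
  have htail : IntegrableOn (fun u : ℝ ↦ ((u - c) ^ 2)⁻¹) (Ioi (c + 1)) := by
    refine integrableOn_Ioi_deriv_of_nonneg (g := fun u : ℝ ↦ -(u - c)⁻¹) (l := 0) ?_ ?_ ?_ ?_
    · have : ContinuousAt (fun u : ℝ ↦ -(u - c)⁻¹) (c + 1) := by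
        have h : (c + 1) - c ≠ 0 := by norm_num
        fun_prop (disch := exact h)
      exact this.continuousWithinAt
    · intro u hu
      have hne : u - c ≠ 0 := by linarith [mem_Ioi.1 hu]
      have h : HasDerivAt (fun u : ℝ ↦ -(u - c)⁻¹) (-(-1 / (u - c) ^ 2)) u :=
        (((hasDerivAt_id u).sub_const c).inv hne).neg
      exact h.congr_deriv (by rw [neg_div, neg_neg, one_div])
    · intro u _; positivity
    · have h1 : Tendsto (fun u : ℝ ↦ (u - c)⁻¹) atTop (𝓝 0) :=
        tendsto_inv_atTop_zero.comp (tendsto_atTop_add_const_right _ _ tendsto_id)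
      simpa using h1.neg
  have htail' : IntegrableOn (fun u : ℝ ↦ ((u - a) * (u - b) * (u - c)) ^ (-(2 / 3) : ℝ))
      (Ioi (c + 1)) := by
    refine Integrable.mono' htail ?_ ?_
    · exact (hcont.mono (Ioi_subset_Ioi (by linarith))).aestronglyMeasurable measurableSet_Ioi
    · refine (ae_restrict_iff' measurableSet_Ioi).2 (Eventually.of_forall fun u hu ↦ ?_)
      have hcu : c < u := by linarith [mem_Ioi.1 hu]
      have h1 : 0 < u - a := by linarith
      have h2 : 0 < u - b := by linarith
      have h3 : 0 < u - c := by linarith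
      rw [Real.norm_of_nonneg (Real.rpow_nonneg (by positivity) _)]
      exact pureProductKernel_le_inv_sq hab hbc hcu
  -- near `c`
  have hnear : IntegrableOn (fun u : ℝ ↦ ((u - a) * (u - b) * (u - c)) ^ (-(2 / 3) : ℝ))
      (Ioc c (c + 1)) :=
    (integrableOn_Ioc_iff_integrableOn_Ioo).2 (integrableOn_pureProductKernel hab hbc (by linarith))
  rw [← Ioc_union_Ioi_eq_Ioi (show c ≤ c + 1 by linarith)]
  exact hnear.union htail'

/-- **Mass of the arc beyond `c`**: `∫_{(c,∞)} ρ = F((b−a)/(c−a))` — the sink running from `c` to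
the point at infinity of `∂ℍ` (improper FTC with `F ∘ η → F(η∞)`). [folklore] -/
theorem integral_pureProduct_Ioi {a b c : ℝ} (hab : a < b) (hbc : b < c) :
    ∫ u in Ioi c, cardyConst / 3 * ((b - a) * (c - b) * (c - a)) ^ (1 / 3 : ℝ) *
        ((u - a) * (u - b) * (u - c)) ^ (-(2 / 3) : ℝ) =
      cardyFunction ((b - a) / (c - a)) := by
  set G : ℝ → ℝ := fun y ↦ cardyFunction (crossRatio ![a, b, c, y]) with hG
  have hGc : G c = 0 := by
    simp only [hG, crossRatio_abcx, sub_self, mul_zero, zero_div, cardyFunction_zero]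
  have hcont : ContinuousWithinAt G (Ici c) c := by
    rw [← continuousWithinAt_Ioi_iff_Ici, ContinuousWithinAt, hGc]
    exact tendsto_cardyFunction_crossRatio_right hab hbc
  have hderiv : ∀ u ∈ Ioi c, HasDerivAt G (cardyConst / 3 * ((b - a) * (c - b) * (c - a)) ^
      (1 / 3 : ℝ) * ((u - a) * (u - b) * (u - c)) ^ (-(2 / 3) : ℝ)) u :=
    fun u hu ↦ hasDerivAt_cardyFunction_crossRatio hab hbc hu
  have hint := (integrableOn_pureProductKernel_Ioi hab hbc).const_mul
    (cardyConst / 3 * ((b - a) * (c - b) * (c - a)) ^ (1 / 3 : ℝ))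
  -- the limit at `+∞`
  have hEta : (b - a) / (c - a) ∈ Ioo (0 : ℝ) 1 := by
    have h1 : 0 < b - a := sub_pos.2 hab
    have h2 : 0 < c - a := sub_pos.2 (hab.trans hbc)
    exact ⟨div_pos h1 h2, (div_lt_one h2).2 (by linarith)⟩
  have hlim : Tendsto G atTop (𝓝 (cardyFunction ((b - a) / (c - a)))) :=
    ((hasDerivAt_cardyFunction_holds hEta).continuousAt.tendsto).comp
      (tendsto_crossRatio_fourth_atTop hab hbc)
  have := integral_Ioi_of_hasDerivAt_of_tendsto hcont hderiv hint hlim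
  rw [this, hGc, sub_zero]

/-- **Mass of the arc before `a`** (the sink between the point at infinity and `a`): by the
reflection `u ↦ −u`, which carries `(a,b,c)` to `(−c,−b,−a)` with the same `Δ`,
`∫_{(−∞,a)} (cardyConst/3)Δ^{1/3}((a−u)(b−u)(c−u))^{−2/3} du = F((c−b)/(c−a))`. [folklore] -/
theorem integral_pureProduct_Iio {a b c : ℝ} (hab : a < b) (hbc : b < c) :
    ∫ u in Iio a, cardyConst / 3 * ((b - a) * (c - b) * (c - a)) ^ (1 / 3 : ℝ) *
        ((a - u) * (b - u) * (c - u)) ^ (-(2 / 3) : ℝ) =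
      cardyFunction ((c - b) / (c - a)) := by
  have h := integral_pureProduct_Ioi (a := -c) (b := -b) (c := -a) (by linarith) (by linarith)
  have hΔ : (-b - -c) * (-a - -b) * (-a - -c) = (b - a) * (c - b) * (c - a) := by ring
  have hη : (-b - -c) / (-a - -c) = (c - b) / (c - a) := by
    rw [show -b - -c = c - b by ring, show -a - -c = c - a by ring]
  rw [hΔ, hη] at h
  rw [← integral_Iic_eq_integral_Iio, ← h, ← neg_neg a, ← integral_comp_neg_Ioi (-a), neg_neg]
  refine setIntegral_congr_fun measurableSet_Ioi fun u _ ↦ ?_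
  congr 1
  ring_nf

/-- **Total mass one.** The pure-product density of the engine crux, normalised by
`cardyConst/3 = 1/B(1/3,1/3)`, has total mass `1` over the whole arc from `c` back to `a`
(through the point at infinity): `F(η∞) + F(1 − η∞) = 1` by the duality symmetry of Cardy's
function (`cardyFunction_one_sub_holds`). This is the continuum side of pinning the crux's
universal constant `C` to `cardyConst/3`. [folklore] -/
theorem integral_pureProduct_Ioi_add_Iio {a b c : ℝ} (hab : a < b) (hbc : b < c) :
    (∫ u in Ioi c, cardyConst / 3 * ((b - a) * (c - b) * (c - a)) ^ (1 / 3 : ℝ) *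
        ((u - a) * (u - b) * (u - c)) ^ (-(2 / 3) : ℝ)) +
      ∫ u in Iio a, cardyConst / 3 * ((b - a) * (c - b) * (c - a)) ^ (1 / 3 : ℝ) *
        ((a - u) * (b - u) * (c - u)) ^ (-(2 / 3) : ℝ) = 1 := by
  rw [integral_pureProduct_Ioi hab hbc, integral_pureProduct_Iio hab hbc]
  have hca : c - a ≠ 0 := (sub_pos.2 (hab.trans hbc)).ne'
  have h1 : (c - b) / (c - a) = 1 - (b - a) / (c - a) := by field_simp; ring
  have hmem : (b - a) / (c - a) ∈ Icc (0 : ℝ) 1 := by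
    have h1 : 0 < b - a := sub_pos.2 hab
    have h2 : 0 < c - a := sub_pos.2 (hab.trans hbc)
    exact ⟨(div_pos h1 h2).le, ((div_lt_one h2).2 (by linarith)).le⟩
  rw [h1, cardyFunction_one_sub_holds hmem]
  ring

end Summit.CriticalPhenomena.CardyFormulaZ2.Theorems

end
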